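import Summits.ValiantsHypothesis.ValiantsHypothesis.Theorems.SymPencilSdcPerFourInnerRankNineSquares

/-!
# Route `SymPencil` — size `≤ 26`: the kernel-package table reduced to the six-dimensional cell
# and the one-row cells (`--supports` stmt-ValiantsHypothesis-5674 `SdcSuperquadratic`; rung
# currency only — a REDUCTION, no new lower bound)

The origin package (`SymPencilPerFourOriginPackage`) of a symmetric affine determinantal
representation of `per_4` of size `m` gives `r = dim im bL ∈ [8, (m-1)/2]`, `V = ker bL ⊆
Sing Z(per_4)` of dimension `16 - r ≤ 8`, and a JOINT family with `d = m - 1 - 2r` squares along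
`V` (`SymPencilIsotropicKernelSquaresBilinear`).  For `m ≤ 26` the cells are

  `(r, dim V, d ≤)` = `(8, 8, 9)`, `(9, 7, 7)`, `(10, 6, 5)`, `(11, 5, 3)`, `(12, 4, m - 25)`.

**Theorem** (`rank_twelve_of_le_twentySix`).  Assume the single cell hypothesis `H106₅`: no
`6`-dimensional `V ⊆ Sing Z(per_4)` carries a joint family with FIVE squares.  Then every
symmetric affine determinantal representation of `per_4` of size `m ≤ 26` over a field of
characteristic `0` has `m ≥ 25`, `dim im bL = 12`, `dim ker bL = 4`, and `ker bL` carries a joint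
family with `m - 25 ∈ {0, 1}` squares — the one-row cells `(12, 4, 0)` (size `25`) and
`(12, 4, 1)` (size `26`).  The other cells are discharged by theorems of the tree:
`(8, 8, 9)` by `SymPencilSdcPerFourInnerRankNineSquares.not_joint_nine_squares_fin`
(val-width-5674-p2, inner rank `≥ 10`), `(9, 7, 7)` by
`SymPencilPerFourLowRankSevenSharp.noLowRank_seven₇` (val-width-5674-p3), `(11, 5, 3)` by
`SymPencilPerFourHessianBlocks.finrank_le_four_of_sum_sq_swap` (val-width-5674-p2 g0).

**Corollaries.**  `cell_of_eq_twentySix`: at `m = 26`, given `H106₅`, the kernel is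
`4`-dimensional, singular, and carries a joint ONE-square family — so `sdc(per_4) ≥ 27` is
equivalent, given `H106₅`, to excluding the cells `(12,4,0)` and `(12,4,1)`.  (At `m = 25` the
`0`-square family makes `per_4` affine along `V`, whence `V` lies in one row or column:
`SymPencilSdcPerFourTwentySixReduction`, `SymPencilSdcPerFourInnerRankH88.
eq_twentyFive_and_oneRowKernel_of_H106`.)

Honest framing: `H106₅` (equivalently the residual trichotomy `R6′` of
`Cruxes/SdcSuperquadratic/NEXT-RUNG-25.md` plus the five-square reading) is OPEN, and so are the
one-row cells (`NC1` of val-width-5676-p2 g4); `sdc(per_4) ≥ 25` remains the tree's value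
(window `25 ≤ sdc(per₄) ≤ 29`); the crux `SdcSuperquadratic` (a bound past the number-of-variables
wall) and `VP ≠ VNP` are untouched.  No definitions, no named facts. [folklore]
-/

noncomputable section

-- single-conjunct layout: Sub = Summit, duplicated namespace component intended
set_option linter.dupNamespace false

namespace Summit.ValiantsHypothesis.ValiantsHypothesis.Theorems.SymPencilSdcPerFourTwentySixCells

open Matrix MvPolynomial Module
open Literature.Computability.AlgebraicComplexity
open Summit.ValiantsHypothesis.ValiantsHypothesis.Theorems.SymPencilPerFourOriginPackage
open Summit.ValiantsHypothesis.ValiantsHypothesis.Theorems.SymPencilIsotropicKernelSquaresBilinear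
open Summit.ValiantsHypothesis.ValiantsHypothesis.Theorems.SymPencilPerFourHessianBlocks
open Summit.ValiantsHypothesis.ValiantsHypothesis.Theorems.SymPencilPerFourLowRankSevenSharp
open Summit.ValiantsHypothesis.ValiantsHypothesis.Theorems.SymPencilBoxFourEquality
open Summit.ValiantsHypothesis.ValiantsHypothesis.Theorems.SymPencilSdcPerFourInnerRankNineSquares

/-- **Size `≤ 26` ⇒ the one-row cells**, given `H106₅`.  See the module docstring.
[folklore] -/
theorem rank_twelve_of_le_twentySix (K : Type*) [Field K] [CharZero K]
    (H106₅ : ∀ V : Submodule K (Fin 4 × Fin 4 → K),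
      (∀ x ∈ V, ∀ (r c : Fin 3 → Fin 4), Function.Injective r → Function.Injective c →
        ((Matrix.of fun i j => x (i, j)).submatrix r c).permanent = 0) →
      finrank K V = 6 → ∀ (c : Fin 5 → K)
        (β : Fin 5 → ((Fin 4 × Fin 4 → K) →ₗ[K] (Fin 4 × Fin 4 → K) →ₗ[K] K)),
      ¬ (∀ u : Fin 4 × Fin 4 → K, ∀ y ∈ V, ∃ e₀ e₁ : K, ∀ s : K,
          eval (u + s • y) (perPoly (Fin 4) K) = e₀ + s * e₁ + s ^ 2 * ∑ k, c k * (β k u y) ^ 2))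
    {m : ℕ} (hm : m ≤ 26) {A : Matrix (Fin m) (Fin m) (MvPolynomial (Fin 4 × Fin 4) K)}
    (hS : A.IsSymm) (hA : IsAffineDetRepr (perPoly (Fin 4) K) A) :
    25 ≤ m ∧
    ∃ (i₀ : Fin m) (D : Matrix {i // i ≠ i₀} {i // i ≠ i₀} K)
      (bL : (Fin 4 × Fin 4 → K) →ₗ[K] ({i // i ≠ i₀} → K))
      (CL : (Fin 4 × Fin 4 → K) →ₗ[K] Matrix {i // i ≠ i₀} {i // i ≠ i₀} K) (κ : K),
      IsUnit D.det ∧ Dᵀ = D ∧ (∀ z, (CL z)ᵀ = CL z) ∧ κ ≠ 0 ∧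
      (∀ z, bL z ⬝ᵥ D⁻¹ *ᵥ bL z = 0) ∧
      (∀ z, bL z ⬝ᵥ (D⁻¹ * CL z * D⁻¹) *ᵥ bL z = 0) ∧
      (∀ z, D.det * (bL z ⬝ᵥ (D⁻¹ * CL z * D⁻¹ * CL z * D⁻¹) *ᵥ bL z) =
        -(κ * eval z (perPoly (Fin 4) K))) ∧
      (∀ x ∈ LinearMap.ker bL, ∀ (r c : Fin 3 → Fin 4), Function.Injective r →
        Function.Injective c → ((Matrix.of fun i j => x (i, j)).submatrix r c).permanent = 0) ∧
      finrank K (LinearMap.range bL) = 12 ∧ finrank K (LinearMap.ker bL) = 4 ∧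
      ∃ (c : Fin (m - 25) → K)
        (β : Fin (m - 25) → ((Fin 4 × Fin 4 → K) →ₗ[K] (Fin 4 × Fin 4 → K) →ₗ[K] K)),
        ∀ u : Fin 4 × Fin 4 → K, ∀ y ∈ LinearMap.ker bL, ∃ e₀ e₁ : K, ∀ s : K,
          eval (u + s • y) (perPoly (Fin 4) K) = e₀ + s * e₁ + s ^ 2 * ∑ k, c k * (β k u y) ^ 2 := by
  classical
  obtain ⟨i₀, D, bL, CL, κ, hD, hDs, hCs, hκ, hi, hii, hiii, hV4, hcard, hranle, hrn, hkerle⟩ :=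
    origin_package_of_isSymm_isAffineDetRepr_perPoly_four K hS hA
  set V := LinearMap.ker bL with hVdef
  have hV3 : ∀ x ∈ V, ∀ (r c : Fin 3 → Fin 4), Function.Injective r → Function.Injective c →
      ((Matrix.of fun i j => x (i, j)).submatrix r c).permanent = 0 :=
    fun x hx r c hr hc => subperm_vanish_inj_of_succAbove x (hV4 x hx) r c hr hc
  -- the joint reading with `d` squares, for every admissible `d`
  have family : ∀ d : ℕ, Fintype.card {i // i ≠ i₀} ≤ 2 * finrank K (LinearMap.range bL) + d →
      ∃ (c : Fin d → K) (β : Fin d → ((Fin 4 × Fin 4 → K) →ₗ[K] (Fin 4 × Fin 4 → K) →ₗ[K] K)),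
        ∀ u : Fin 4 × Fin 4 → K, ∀ y ∈ V, ∃ e₀ e₁ : K, ∀ s : K,
          eval (u + s • y) (perPoly (Fin 4) K) = e₀ + s * e₁ + s ^ 2 * ∑ k, c k * (β k u y) ^ 2 := by
    intro d hd
    obtain ⟨c, β, hcβ⟩ := sum_sq_of_isotropic_defect_bilinear hD hDs bL CL hCs
      (fun z => eval z (perPoly (Fin 4) K)) hκ hi hii hiii d hd
    exact ⟨c, β, fun u y hy => hcβ u y (LinearMap.mem_ker.1 hy)⟩
  have hcard' : Fintype.card {i // i ≠ i₀} ≤ 25 := by omega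
  -- case analysis on `r = dim im bL ∈ [8, 12]`
  have hr : finrank K (LinearMap.range bL) = 8 ∨ finrank K (LinearMap.range bL) = 9 ∨
      finrank K (LinearMap.range bL) = 10 ∨ finrank K (LinearMap.range bL) = 11 ∨
      finrank K (LinearMap.range bL) = 12 := by omega
  rcases hr with h8 | h9 | h10 | h11 | h12
  · -- `dim V = 8`, at most `9` squares: inner rank `≥ 10`
    exfalso
    obtain ⟨c, β, hcβ⟩ := family 9 (by omega)
    exact not_joint_nine_squares_fin K V hV3 (by omega) c β hcβ
  · -- `dim V = 7`, at most `7` squares: the per-direction reading has rank `≤ 7 < 8`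
    exfalso
    obtain ⟨c, β, hcβ⟩ := family 7 (by omega)
    refine noLowRank_seven₇ V hV3 (by omega) c fun y hy => ⟨fun k => (β k).flip y, fun u => ?_⟩
    obtain ⟨e₀, e₁, he⟩ := hcβ u y hy
    exact ⟨e₀, e₁, fun s => by simpa only [LinearMap.flip_apply] using he s⟩
  · -- `dim V = 6`, at most `5` squares: the cell hypothesis `H106₅`
    exfalso
    obtain ⟨c, β, hcβ⟩ := family 5 (by omega)
    exact H106₅ V hV3 (by omega) c β hcβ
  · -- `dim V = 5`, at most `3` squares: the per-direction reading forces `dim V ≤ 4`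
    exfalso
    obtain ⟨c, β, hcβ⟩ := family 3 (by omega)
    have h4 := finrank_le_four_of_sum_sq_swap (ι := Fin 3) (by rw [Fintype.card_fin]; norm_num) V
      fun y hy => ⟨c, fun k => (β k).flip y, fun u => by
        obtain ⟨e₀, e₁, he⟩ := hcβ u y hy
        exact ⟨e₀, e₁, fun s => by simpa only [LinearMap.flip_apply] using he s⟩⟩
    omega
  · -- `dim V = 4`, `r = 12`: `m - 1 ≥ 24`, and the family with `m - 25` squares
    obtain ⟨c, β, hcβ⟩ := family (m - 25) (by omega)
    have hk4 : finrank K (LinearMap.ker bL) = 4 := by rw [← hVdef]; omega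
    exact ⟨by omega, i₀, D, bL, CL, κ, hD, hDs, hCs, hκ, hi, hii, hiii, hV3, h12, hk4, c, β, hcβ⟩

/-- **The size-`26` cell.**  Given `H106₅`, a symmetric affine determinantal representation of
`per_4` of size exactly `26` has a `4`-dimensional singular kernel `V = ker bL` with Lagrangian
complement data (`dim im bL = 12`) carrying a joint ONE-square family
`per_4 (u + s y) = e₀ + e₁ s + c (β(u,y))² s²` (`y ∈ V`): the cell `(12, 4, 1)`. [folklore] -/
theorem cell_of_eq_twentySix (K : Type*) [Field K] [CharZero K]
    (H106₅ : ∀ V : Submodule K (Fin 4 × Fin 4 → K),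
      (∀ x ∈ V, ∀ (r c : Fin 3 → Fin 4), Function.Injective r → Function.Injective c →
        ((Matrix.of fun i j => x (i, j)).submatrix r c).permanent = 0) →
      finrank K V = 6 → ∀ (c : Fin 5 → K)
        (β : Fin 5 → ((Fin 4 × Fin 4 → K) →ₗ[K] (Fin 4 × Fin 4 → K) →ₗ[K] K)),
      ¬ (∀ u : Fin 4 × Fin 4 → K, ∀ y ∈ V, ∃ e₀ e₁ : K, ∀ s : K,
          eval (u + s • y) (perPoly (Fin 4) K) = e₀ + s * e₁ + s ^ 2 * ∑ k, c k * (β k u y) ^ 2))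
    {A : Matrix (Fin 26) (Fin 26) (MvPolynomial (Fin 4 × Fin 4) K)}
    (hS : A.IsSymm) (hA : IsAffineDetRepr (perPoly (Fin 4) K) A) :
    ∃ (V : Submodule K (Fin 4 × Fin 4 → K)),
      (∀ x ∈ V, ∀ (r c : Fin 3 → Fin 4), Function.Injective r → Function.Injective c →
        ((Matrix.of fun i j => x (i, j)).submatrix r c).permanent = 0) ∧
      finrank K V = 4 ∧
      ∃ (c : K) (β : (Fin 4 × Fin 4 → K) →ₗ[K] (Fin 4 × Fin 4 → K) →ₗ[K] K),
        ∀ u : Fin 4 × Fin 4 → K, ∀ y ∈ V, ∃ e₀ e₁ : K, ∀ s : K,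
          eval (u + s • y) (perPoly (Fin 4) K) = e₀ + s * e₁ + s ^ 2 * (c * (β u y) ^ 2) := by
  obtain ⟨-, i₀, D, bL, CL, κ, -, -, -, -, -, -, -, hV3, -, h4, c, β, hcβ⟩ :=
    rank_twelve_of_le_twentySix K H106₅ (le_refl 26) hS hA
  refine ⟨LinearMap.ker bL, hV3, h4, c 0, β 0, fun u y hy => ?_⟩
  obtain ⟨e₀, e₁, he⟩ := hcβ u y hy
  refine ⟨e₀, e₁, fun s => ?_⟩
  rw [he s]
  simp

open Summit.ValiantsHypothesis.ValiantsHypothesis.Theorems.SymPencilPerFourBlocksEq in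
/-- **Size `≤ 26` ⇒ a one-row (one-column) kernel**, given `H106₅`.  The joint family with
`m - 25 ≤ 1 < 4` squares of `rank_twelve_of_le_twentySix`, read per direction `y ∈ ker bL`, kills
all `2 × 2` subpermanents of `y` (`SymPencilPerFourHessianBlocks.perm_two_blocks_of_sum_sq_swap`),
and a `4`-dimensional space of such matrices is a single row or column
(`SymPencilPerFourBlocksEq.row_or_col_of_perm_two_blocks`).  So at the sizes `25` AND `26` the
only cell left besides `(10, 6, ·)` is the one-row kernel — val-width-5676-p2's `NC1` normal form
and its size-`26` analogue. [folklore] -/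
theorem oneRow_of_le_twentySix (K : Type*) [Field K] [CharZero K]
    (H106₅ : ∀ V : Submodule K (Fin 4 × Fin 4 → K),
      (∀ x ∈ V, ∀ (r c : Fin 3 → Fin 4), Function.Injective r → Function.Injective c →
        ((Matrix.of fun i j => x (i, j)).submatrix r c).permanent = 0) →
      finrank K V = 6 → ∀ (c : Fin 5 → K)
        (β : Fin 5 → ((Fin 4 × Fin 4 → K) →ₗ[K] (Fin 4 × Fin 4 → K) →ₗ[K] K)),
      ¬ (∀ u : Fin 4 × Fin 4 → K, ∀ y ∈ V, ∃ e₀ e₁ : K, ∀ s : K,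
          eval (u + s • y) (perPoly (Fin 4) K) = e₀ + s * e₁ + s ^ 2 * ∑ k, c k * (β k u y) ^ 2))
    {m : ℕ} (hm : m ≤ 26) {A : Matrix (Fin m) (Fin m) (MvPolynomial (Fin 4 × Fin 4) K)}
    (hS : A.IsSymm) (hA : IsAffineDetRepr (perPoly (Fin 4) K) A) :
    25 ≤ m ∧
    ∃ (i₀ : Fin m) (D : Matrix {i // i ≠ i₀} {i // i ≠ i₀} K)
      (bL : (Fin 4 × Fin 4 → K) →ₗ[K] ({i // i ≠ i₀} → K))
      (CL : (Fin 4 × Fin 4 → K) →ₗ[K] Matrix {i // i ≠ i₀} {i // i ≠ i₀} K) (κ : K),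
      IsUnit D.det ∧ Dᵀ = D ∧ (∀ z, (CL z)ᵀ = CL z) ∧ κ ≠ 0 ∧
      (∀ z, bL z ⬝ᵥ D⁻¹ *ᵥ bL z = 0) ∧
      (∀ z, bL z ⬝ᵥ (D⁻¹ * CL z * D⁻¹) *ᵥ bL z = 0) ∧
      (∀ z, D.det * (bL z ⬝ᵥ (D⁻¹ * CL z * D⁻¹ * CL z * D⁻¹) *ᵥ bL z) =
        -(κ * eval z (perPoly (Fin 4) K))) ∧
      finrank K (LinearMap.range bL) = 12 ∧ finrank K (LinearMap.ker bL) = 4 ∧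
      ((∃ l : Fin 4, ∀ x ∈ LinearMap.ker bL, ∀ i j : Fin 4, i ≠ l → x (i, j) = 0) ∨
       (∃ c : Fin 4, ∀ x ∈ LinearMap.ker bL, ∀ i j : Fin 4, j ≠ c → x (i, j) = 0)) := by
  obtain ⟨h25, i₀, D, bL, CL, κ, hD, hDs, hCs, hκ, hi, hii, hiii, -, h12, h4, c, β, hcβ⟩ :=
    rank_twelve_of_le_twentySix K H106₅ hm hS hA
  refine ⟨h25, i₀, D, bL, CL, κ, hD, hDs, hCs, hκ, hi, hii, hiii, h12, h4, ?_⟩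
  have hB : ∀ y ∈ LinearMap.ker bL, ∀ i k j l : Fin 4, i ≠ k → j ≠ l →
      y (i, j) * y (k, l) + y (i, l) * y (k, j) = 0 := fun y hy =>
    perm_two_blocks_of_sum_sq_swap (ι := Fin (m - 25)) (by rw [Fintype.card_fin]; omega) y
      ⟨c, fun k => (β k).flip y, fun u => by
        obtain ⟨e₀, e₁, he⟩ := hcβ u y hy
        exact ⟨e₀, e₁, fun s => by simpa only [LinearMap.flip_apply] using he s⟩⟩
  exact row_or_col_of_perm_two_blocks (LinearMap.ker bL) hB h4

end Summit.ValiantsHypothesis.ValiantsHypothesis.Theorems.SymPencilSdcPerFourTwentySixCells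

end
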